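import Literature.Analysis.FluidPDE.BackwardUniquenessCutoff
import Literature.Analysis.FluidPDE.CarlemanSecond
import HarnessLib

/-!
# Cut-off calculus for the anisotropic Carleman argument (Seregin 2014, proof of Lemma A.3)

Analysis/FluidPDE support file (theorems only) in the backward-uniqueness track of **ns.S08**
(`ess_backward_uniqueness`, ESS 2003 Thm. 5.1 = Seregin 2014, Thm. A.3.5). In the proof of
Lemma A.3 (Seregin 2014, p. 213) the second Carleman inequality (Prop. 1.3, proved:
`Carleman.carleman_inequality_second_of_contDiff_two`) is applied to `w = η v` with the
anisotropic cut-off `η(y, s) = ψ₁(yₙ) ψ₂(φ_B(yₙ, s)/B)`, `φ_B(yₙ, s) = (1 - s) yₙ^{2α}/s^α - B`,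
`yₙ = ⟪y, e⟫`, supplemented (since `w` is "not compactly supported in `Q¹₊`") by cut-offs at
large `|y'|`, `|y'|² = |y|² - yₙ²`, and large `yₙ`. All these factors are functions either of
the two real variables `(s, yₙ)` or of `|y'|²`; this file provides the corresponding calculus
in the frame operators `Carleman.dt`, `Carleman.dx`, `Carleman.lap`, `Carleman.gradSq`:

* functions `N(s, y) = T(s, ⟪y, e⟫)` of `(s, yₙ)` for `T : ℝ × ℝ → ℝ` (`‖e‖ = 1`):
  `∂ₛN = ∂ₛT`, `∂_{e'}N = ⟪e', e⟫ ∂ᵣT`, `|∇N|² = (∂ᵣT)²`, `ΔN = ∂ᵣᵣT` (the derivatives of `T`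
  being the frame operators on `ℝ × ℝ`);
* profiles `(s, r) ↦ g(r)` on `ℝ × ℝ`;
* the function `|y'|² = ‖y‖² - ⟪y, e⟫²`: `∂ₛ = 0`, `|∇|y'|²|² = 4|y'|²`, `Δ|y'|² = 2(n - 1)`,
  `0 ≤ |y'|² ≤ ‖y‖²`.

All statements are proved; no definitions.

## References

* G. Seregin, *Lecture notes on regularity theory for the Navier–Stokes equations*, World
  Scientific 2014, App. A.3, proof of Lemma A.3 (the cut-offs `ψ₁`, `ψ₂`, `φ_B`, `η`),
  p. 213. [Seregin2014]
-/

noncomputable section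

open Set Function Filter Metric
open _root_.Topology
open scoped InnerProductSpace RealInnerProductSpace

namespace Literature.Analysis.FluidPDE

namespace Carleman

/-! ### Functions of `(s, ⟪y, e⟫)` -/

section PairInner

variable {E : Type*} [NormedAddCommGroup E] [InnerProductSpace ℝ E]

/-- The map `(s, y) ↦ (s, ⟪y, e⟫)` has derivative `(σ, η) ↦ (σ, ⟪η, e⟫)`. [folklore] -/
theorem hasFDerivAt_pairInner (e : E) (z : ℝ × E) :
    HasFDerivAt (fun y : ℝ × E => ((y.1, ⟪y.2, e⟫) : ℝ × ℝ))
      ((ContinuousLinearMap.fst ℝ ℝ E).prod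
        ((innerSL ℝ e).comp (ContinuousLinearMap.snd ℝ ℝ E))) z := by
  have h : (fun y : ℝ × E => ((y.1, ⟪y.2, e⟫) : ℝ × ℝ)) =
      fun y => ((ContinuousLinearMap.fst ℝ ℝ E).prod
        ((innerSL ℝ e).comp (ContinuousLinearMap.snd ℝ ℝ E))) y := by
    funext y
    simp [real_inner_comm]
  rw [h]
  exact ContinuousLinearMap.hasFDerivAt _

/-- The map `(s, y) ↦ (s, ⟪y, e⟫)` is smooth. [folklore] -/
theorem contDiff_pairInner (e : E) {n : WithTop ℕ∞} :
    ContDiff ℝ n fun y : ℝ × E => ((y.1, ⟪y.2, e⟫) : ℝ × ℝ) :=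
  contDiff_fst.prodMk (contDiff_snd.inner ℝ contDiff_const)

/-- **Chain rule for `N = T(s, ⟪y, e⟫)`**: `DN(z) v = DT(s, ⟪y,e⟫) (v₁, ⟪v₂, e⟫)`. [folklore] -/
theorem fderiv_comp_pairInner_apply {T : ℝ × ℝ → ℝ} {e : E} {z : ℝ × E}
    (hT : DifferentiableAt ℝ T (z.1, ⟪z.2, e⟫)) (v : ℝ × E) :
    fderiv ℝ (fun y : ℝ × E => T (y.1, ⟪y.2, e⟫)) z v =
      fderiv ℝ T (z.1, ⟪z.2, e⟫) (v.1, ⟪v.2, e⟫) := by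
  have h : HasFDerivAt (fun y : ℝ × E => T (y.1, ⟪y.2, e⟫))
      ((fderiv ℝ T (z.1, ⟪z.2, e⟫)).comp ((ContinuousLinearMap.fst ℝ ℝ E).prod
        ((innerSL ℝ e).comp (ContinuousLinearMap.snd ℝ ℝ E)))) z :=
    hT.hasFDerivAt.comp z (hasFDerivAt_pairInner e z)
  rw [h.fderiv]
  simp [real_inner_comm]

/-- `∂ₛN = ∂ₛT` at `(s, ⟪y, e⟫)`. [folklore] -/
theorem dt_comp_pairInner {T : ℝ × ℝ → ℝ} {e : E} {z : ℝ × E}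
    (hT : DifferentiableAt ℝ T (z.1, ⟪z.2, e⟫)) :
    dt (fun y : ℝ × E => T (y.1, ⟪y.2, e⟫)) z = dt T (z.1, ⟪z.2, e⟫) := by
  rw [dt_apply, dt_apply, fderiv_comp_pairInner_apply hT]
  simp

/-- `∂_{e'}N = ⟪e', e⟫ ∂ᵣT` at `(s, ⟪y, e⟫)` (`∂ᵣ = dx 1` on `ℝ × ℝ`). [folklore] -/
theorem dx_comp_pairInner {T : ℝ × ℝ → ℝ} {e : E} {z : ℝ × E}
    (hT : DifferentiableAt ℝ T (z.1, ⟪z.2, e⟫)) (e' : E) :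
    dx e' (fun y : ℝ × E => T (y.1, ⟪y.2, e⟫)) z = ⟪e', e⟫ * dx (1 : ℝ) T (z.1, ⟪z.2, e⟫) := by
  rw [dx_apply, dx_apply, fderiv_comp_pairInner_apply hT]
  simp only
  rw [show (((0 : ℝ), ⟪e', e⟫) : ℝ × ℝ) = ⟪e', e⟫ • ((0 : ℝ), (1 : ℝ)) by simp, map_smul,
    smul_eq_mul]

/-- Second derivatives: `∂_{e'}∂_{e'}N = ⟪e', e⟫² ∂ᵣᵣT` for `T` of class `C²` on an open set
containing `(s, ⟪y, e⟫)`. [folklore] -/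
theorem dx_dx_comp_pairInner {T : ℝ × ℝ → ℝ} {Ω : Set (ℝ × ℝ)} {e : E} {z : ℝ × E}
    (hΩ : IsOpen Ω) (hT : ContDiffOn ℝ 2 T Ω) (hz : (z.1, ⟪z.2, e⟫) ∈ Ω) (e' : E) :
    dx e' (dx e' fun y : ℝ × E => T (y.1, ⟪y.2, e⟫)) z =
      ⟪e', e⟫ ^ 2 * dx (1 : ℝ) (dx (1 : ℝ) T) (z.1, ⟪z.2, e⟫) := by
  have hTd : ∀ w ∈ Ω, DifferentiableAt ℝ T w := fun w hw =>
    (hT.differentiableOn (by norm_num)).differentiableAt (hΩ.mem_nhds hw)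
  -- the preimage of `Ω` is an open neighbourhood of `z`
  have hpre : IsOpen ((fun y : ℝ × E => ((y.1, ⟪y.2, e⟫) : ℝ × ℝ)) ⁻¹' Ω) :=
    hΩ.preimage (contDiff_pairInner (n := 0) e).continuous
  have hev : dx e' (fun y : ℝ × E => T (y.1, ⟪y.2, e⟫)) =ᶠ[𝓝 z]
      fun y => ⟪e', e⟫ * dx (1 : ℝ) T (y.1, ⟪y.2, e⟫) := by
    filter_upwards [hpre.mem_nhds hz] with y hy
    exact dx_comp_pairInner (hTd _ hy) e'
  -- `dx 1 T` is differentiable at `(s, ⟪y, e⟫)`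
  have hT1 : DifferentiableAt ℝ (dx (1 : ℝ) T) (z.1, ⟪z.2, e⟫) := by
    have hc : ContDiffOn ℝ 1 (fun w => fderiv ℝ T w ((0 : ℝ), (1 : ℝ))) Ω :=
      (hT.fderiv_of_isOpen hΩ le_rfl).clm_apply contDiffOn_const
    exact (hc.differentiableOn one_ne_zero).differentiableAt (hΩ.mem_nhds hz)
  have hd : DifferentiableAt ℝ (fun y : ℝ × E => dx (1 : ℝ) T (y.1, ⟪y.2, e⟫)) z := by
    exact hT1.comp z ((contDiff_pairInner (n := 1) e).differentiable one_ne_zero z)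
  rw [dx_apply, hev.fderiv_eq, fderiv_const_mul hd]
  simp only [FunLike.coe_smul, Pi.smul_apply, smul_eq_mul]
  rw [← dx_apply, dx_comp_pairInner hT1 e']
  ring

variable [FiniteDimensional ℝ E]

/-- `ΔN = ∂ᵣᵣT` (for a unit vector `e`: `Σᵢ ⟪bᵢ, e⟫² = 1`). [folklore] -/
theorem lap_comp_pairInner {T : ℝ × ℝ → ℝ} {Ω : Set (ℝ × ℝ)} {e : E} {z : ℝ × E}
    (he : ‖e‖ = 1) (hΩ : IsOpen Ω) (hT : ContDiffOn ℝ 2 T Ω) (hz : (z.1, ⟪z.2, e⟫) ∈ Ω) :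
    lap (fun y : ℝ × E => T (y.1, ⟪y.2, e⟫)) z = dx (1 : ℝ) (dx (1 : ℝ) T) (z.1, ⟪z.2, e⟫) := by
  simp only [lap, dx_dx_comp_pairInner hΩ hT hz, ← Finset.sum_mul]
  rw [show ∑ i, ⟪stdOrthonormalBasis ℝ E i, e⟫ ^ 2 = ‖e‖ ^ 2 from
    (stdOrthonormalBasis ℝ E).sum_sq_inner_right e, he]
  ring

/-- `|∇N|² = (∂ᵣT)²` (for a unit vector `e`). [folklore] -/
theorem gradSq_comp_pairInner {T : ℝ × ℝ → ℝ} {e : E} {z : ℝ × E} (he : ‖e‖ = 1)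
    (hT : DifferentiableAt ℝ T (z.1, ⟪z.2, e⟫)) :
    gradSq (fun y : ℝ × E => T (y.1, ⟪y.2, e⟫)) z = dx (1 : ℝ) T (z.1, ⟪z.2, e⟫) ^ 2 := by
  simp only [gradSq, dx_comp_pairInner hT, Real.norm_eq_abs, sq_abs, mul_pow, ← Finset.sum_mul]
  rw [show ∑ i, ⟪stdOrthonormalBasis ℝ E i, e⟫ ^ 2 = ‖e‖ ^ 2 from
    (stdOrthonormalBasis ℝ E).sum_sq_inner_right e, he]
  ring

end PairInner

/-! ### Profiles in the second variable on `ℝ × ℝ` -/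

section SndProfile

/-- `∂ₛ g(r) = 0` on `ℝ × ℝ`. [folklore] -/
theorem dt_sndProfile {g : ℝ → ℝ} {w : ℝ × ℝ} (hg : DifferentiableAt ℝ g w.2) :
    dt (fun w : ℝ × ℝ => g w.2) w = 0 := by
  have h : HasFDerivAt (fun w : ℝ × ℝ => g w.2)
      ((ContinuousLinearMap.smulRight (1 : ℝ →L[ℝ] ℝ) (deriv g w.2)).comp
        (ContinuousLinearMap.snd ℝ ℝ ℝ)) w :=
    hg.hasDerivAt.hasFDerivAt.comp w hasFDerivAt_snd
  rw [dt_apply, h.fderiv]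
  simp

/-- `∂ᵣ g(r) = g'(r)` on `ℝ × ℝ` (`∂ᵣ = dx 1`). [folklore] -/
theorem dx_sndProfile {g : ℝ → ℝ} {w : ℝ × ℝ} (hg : DifferentiableAt ℝ g w.2) :
    dx (1 : ℝ) (fun w : ℝ × ℝ => g w.2) w = deriv g w.2 := by
  have h : HasFDerivAt (fun w : ℝ × ℝ => g w.2)
      ((ContinuousLinearMap.smulRight (1 : ℝ →L[ℝ] ℝ) (deriv g w.2)).comp
        (ContinuousLinearMap.snd ℝ ℝ ℝ)) w :=
    hg.hasDerivAt.hasFDerivAt.comp w hasFDerivAt_snd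
  rw [dx_apply, h.fderiv]
  simp

/-- `∂ᵣ∂ᵣ g(r) = g''(r)` on `ℝ × ℝ` for `g ∈ C²`. [folklore] -/
theorem dx_dx_sndProfile {g : ℝ → ℝ} (hg : ContDiff ℝ 2 g) (w : ℝ × ℝ) :
    dx (1 : ℝ) (dx (1 : ℝ) fun w : ℝ × ℝ => g w.2) w = deriv (deriv g) w.2 := by
  have hgd : Differentiable ℝ g := hg.differentiable (by norm_num)
  have h1 : dx (1 : ℝ) (fun w : ℝ × ℝ => g w.2) = fun w => deriv g w.2 :=
    funext fun w => dx_sndProfile (hgd _)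
  have hg1 : ContDiff ℝ 1 (deriv g) := by simpa using hg.iterate_deriv' 1 1
  rw [h1, dx_sndProfile ((hg1.differentiable one_ne_zero) _)]

end SndProfile

/-! ### The function `|y'|² = ‖y‖² - ⟪y, e⟫²` -/

section YPrime

variable {E : Type*} [NormedAddCommGroup E] [InnerProductSpace ℝ E]

/-- `|y'|² = ‖y‖² - ⟪y, e⟫²` is smooth. [folklore] -/
theorem contDiff_normSq_sub_innerSq (e : E) {n : WithTop ℕ∞} :
    ContDiff ℝ n fun y : ℝ × E => ‖y.2‖ ^ 2 - ⟪y.2, e⟫ ^ 2 :=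
  contDiff_norm_sq_snd.sub ((contDiff_inner_snd_const e).pow 2)

/-- `0 ≤ |y'|²` for a unit vector `e` (Cauchy–Schwarz). [folklore] -/
theorem normSq_sub_innerSq_nonneg {e : E} (he : ‖e‖ = 1) (y : E) : 0 ≤ ‖y‖ ^ 2 - ⟪y, e⟫ ^ 2 := by
  have h : |⟪y, e⟫| ≤ ‖y‖ := by
    have := abs_real_inner_le_norm y e; rwa [he, mul_one] at this
  nlinarith [abs_nonneg ⟪y, e⟫, sq_abs ⟪y, e⟫]

/-- `|y'|² ≤ ‖y‖²`. [folklore] -/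
theorem normSq_sub_innerSq_le (e y : E) : ‖y‖ ^ 2 - ⟪y, e⟫ ^ 2 ≤ ‖y‖ ^ 2 := by
  nlinarith [sq_nonneg ⟪y, e⟫]

/-- Derivative of `⟪y, e⟫²` along `v`: `2⟪y, e⟫⟪v₂, e⟫`. [folklore] -/
theorem fderiv_innerSq_apply (e : E) (z v : ℝ × E) :
    fderiv ℝ (fun y : ℝ × E => ⟪y.2, e⟫ ^ 2) z v = 2 * ⟪z.2, e⟫ * ⟪v.2, e⟫ := by
  have hd : DifferentiableAt ℝ (fun y : ℝ × E => ⟪y.2, e⟫) z :=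
    (contDiff_inner_snd_const e (n := 1)).differentiable one_ne_zero z
  rw [show (fun y : ℝ × E => ⟪y.2, e⟫ ^ 2) = fun y => ⟪y.2, e⟫ * ⟪y.2, e⟫ by funext y; ring,
    fderiv_fun_mul hd hd]
  simp only [_root_.add_apply, FunLike.coe_smul, Pi.smul_apply, smul_eq_mul,
    fderiv_inner_snd_const]
  ring

/-- `∂ₛ |y'|² = 0`. [folklore] -/
theorem dt_normSq_sub_innerSq (e : E) (z : ℝ × E) :
    dt (fun y : ℝ × E => ‖y.2‖ ^ 2 - ⟪y.2, e⟫ ^ 2) z = 0 := by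
  have h1 : DifferentiableAt ℝ (fun y : ℝ × E => ‖y.2‖ ^ 2) z :=
    (contDiff_norm_sq_snd (n := 1)).differentiable one_ne_zero z
  have h2 : DifferentiableAt ℝ (fun y : ℝ × E => ⟪y.2, e⟫ ^ 2) z :=
    ((contDiff_inner_snd_const e (n := 1)).pow 2).differentiable one_ne_zero z
  rw [dt_apply, fderiv_fun_sub h1 h2, _root_.sub_apply, fderiv_norm_sq_snd_apply,
    fderiv_innerSq_apply]
  simp

/-- `∂_{e'} |y'|² = 2⟪y, e'⟫ - 2⟪y, e⟫⟪e', e⟫`. [folklore] -/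
theorem dx_normSq_sub_innerSq (e e' : E) (z : ℝ × E) :
    dx e' (fun y : ℝ × E => ‖y.2‖ ^ 2 - ⟪y.2, e⟫ ^ 2) z =
      2 * ⟪z.2, e'⟫ - 2 * ⟪z.2, e⟫ * ⟪e', e⟫ := by
  have h1 : DifferentiableAt ℝ (fun y : ℝ × E => ‖y.2‖ ^ 2) z :=
    (contDiff_norm_sq_snd (n := 1)).differentiable one_ne_zero z
  have h2 : DifferentiableAt ℝ (fun y : ℝ × E => ⟪y.2, e⟫ ^ 2) z :=
    ((contDiff_inner_snd_const e (n := 1)).pow 2).differentiable one_ne_zero z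
  rw [dx_apply, fderiv_fun_sub h1 h2, _root_.sub_apply, fderiv_norm_sq_snd_apply,
    fderiv_innerSq_apply]

variable [FiniteDimensional ℝ E]

/-- `|∇|y'|²|² = 4|y'|²` for a unit vector `e`. [folklore] -/
theorem gradSq_normSq_sub_innerSq {e : E} (he : ‖e‖ = 1) (z : ℝ × E) :
    gradSq (fun y : ℝ × E => ‖y.2‖ ^ 2 - ⟪y.2, e⟫ ^ 2) z = 4 * (‖z.2‖ ^ 2 - ⟪z.2, e⟫ ^ 2) := by
  simp only [gradSq, dx_normSq_sub_innerSq, Real.norm_eq_abs, sq_abs]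
  have e1 : ∀ i, (2 * ⟪z.2, stdOrthonormalBasis ℝ E i⟫ -
      2 * ⟪z.2, e⟫ * ⟪stdOrthonormalBasis ℝ E i, e⟫) ^ 2 =
      4 * ⟪z.2, stdOrthonormalBasis ℝ E i⟫ ^ 2 -
        8 * ⟪z.2, e⟫ * (⟪z.2, stdOrthonormalBasis ℝ E i⟫ * ⟪stdOrthonormalBasis ℝ E i, e⟫) +
        4 * ⟪z.2, e⟫ ^ 2 * ⟪stdOrthonormalBasis ℝ E i, e⟫ ^ 2 := fun i => by ring
  simp only [e1, Finset.sum_add_distrib, Finset.sum_sub_distrib, ← Finset.mul_sum]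
  rw [(stdOrthonormalBasis ℝ E).sum_sq_inner_left, (stdOrthonormalBasis ℝ E).sum_inner_mul_inner,
    (stdOrthonormalBasis ℝ E).sum_sq_inner_right, he]
  ring

/-- `Δ|y'|² = 2(dim E - 1)` for a unit vector `e`. [folklore] -/
theorem lap_normSq_sub_innerSq {e : E} (he : ‖e‖ = 1) (z : ℝ × E) :
    lap (fun y : ℝ × E => ‖y.2‖ ^ 2 - ⟪y.2, e⟫ ^ 2) z = 2 * ((Module.finrank ℝ E : ℝ) - 1) := by
  have h1 : ∀ e' : E, dx e' (fun y : ℝ × E => ‖y.2‖ ^ 2 - ⟪y.2, e⟫ ^ 2) =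
      fun y => 2 * ⟪y.2, e'⟫ - 2 * ⟪y.2, e⟫ * ⟪e', e⟫ := fun e' =>
    funext fun y => dx_normSq_sub_innerSq e e' y
  have h2 : ∀ e' : E, dx e' (dx e' fun y : ℝ × E => ‖y.2‖ ^ 2 - ⟪y.2, e⟫ ^ 2) z =
      2 * ‖e'‖ ^ 2 - 2 * ⟪e', e⟫ ^ 2 := by
    intro e'
    rw [h1 e', dx_apply]
    have hd1 : DifferentiableAt ℝ (fun y : ℝ × E => 2 * ⟪y.2, e'⟫) z :=
      ((contDiff_inner_snd_const e' (n := 1)).differentiable one_ne_zero z).const_mul 2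
    have hd2 : DifferentiableAt ℝ (fun y : ℝ × E => 2 * ⟪y.2, e⟫ * ⟪e', e⟫) z :=
      (((contDiff_inner_snd_const e (n := 1)).differentiable one_ne_zero z).const_mul 2).mul_const _
    rw [fderiv_fun_sub hd1 hd2, fderiv_const_mul ((contDiff_inner_snd_const e' (n := 1)).differentiable
      one_ne_zero z), fderiv_mul_const ((((contDiff_inner_snd_const e (n := 1)).differentiable
      one_ne_zero z).const_mul 2)), fderiv_const_mul ((contDiff_inner_snd_const e (n := 1)).differentiable
      one_ne_zero z)]
    simp only [FunLike.coe_sub, Pi.sub_apply, FunLike.coe_smul,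
      Pi.smul_apply, smul_eq_mul, fderiv_inner_snd_const, real_inner_self_eq_norm_sq]
    ring
  simp only [lap, h2, Finset.sum_sub_distrib, ← Finset.mul_sum,
    (stdOrthonormalBasis ℝ E).orthonormal.1, one_pow, Finset.sum_const, Finset.card_univ,
    Fintype.card_fin, nsmul_eq_mul, mul_one]
  rw [(stdOrthonormalBasis ℝ E).sum_sq_inner_right, he]
  ring

omit [FiniteDimensional ℝ E] in
/-- `∂ₑ |y'|² = 0` (the direction `e` itself). [folklore] -/
theorem dx_self_normSq_sub_innerSq {e : E} (he : ‖e‖ = 1) (z : ℝ × E) :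
    dx e (fun y : ℝ × E => ‖y.2‖ ^ 2 - ⟪y.2, e⟫ ^ 2) z = 0 := by
  rw [dx_normSq_sub_innerSq, real_inner_self_eq_norm_sq, he]
  ring

end YPrime

/-! ### The level-set function `K(s, r) = (k(s) ρ(r) - B)/B` of the anisotropic weight -/

section LevelSet

/-- Values of `k = k_{3/4}` on `[1/2, 1]`: `0 ≤ k(s) ≤ 1`. [folklore] -/
theorem kA_mem_Icc {s : ℝ} (hs : 1 / 2 ≤ s) (hs1 : s ≤ 1) :
    0 ≤ kA (3 / 4) s ∧ kA (3 / 4) s ≤ 1 := by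
  have hs0 : 0 < s := by linarith
  rw [kA_eq _ hs0]
  have h1 : s ^ (-(3 / 4 : ℝ)) ≤ 2 := by
    have h2 : s ^ (-(3 / 4 : ℝ)) ≤ (1 / 2 : ℝ) ^ (-(3 / 4 : ℝ)) :=
      Real.rpow_le_rpow_of_nonpos (by norm_num) hs (by norm_num)
    have h3 : (1 / 2 : ℝ) ^ (-(3 / 4 : ℝ)) ≤ (1 / 2 : ℝ) ^ (-(1 : ℝ)) :=
      Real.rpow_le_rpow_of_exponent_ge (by norm_num) (by norm_num) (by norm_num)
    have h4 : (1 / 2 : ℝ) ^ (-(1 : ℝ)) = 2 := by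
      rw [Real.rpow_neg (by norm_num), Real.rpow_one]; norm_num
    linarith
  have h0 : 0 ≤ s ^ (-(3 / 4 : ℝ)) := Real.rpow_nonneg hs0.le _
  constructor
  · exact mul_nonneg (by linarith) h0
  · nlinarith

/-- `k(s) ≤ 0` for `s ≥ 1`. [folklore] -/
theorem kA_nonpos {s : ℝ} (hs1 : 1 ≤ s) : kA (3 / 4) s ≤ 0 := by
  rw [kA_eq _ (by linarith)]
  exact mul_nonpos_of_nonpos_of_nonneg (by linarith) (Real.rpow_nonneg (by linarith) _)

/-- `|k'(s)| ≤ 4` on `[1/2, 1]` (`k' = -s^{-α}(α(1-s) + s)/s`). [folklore] -/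
theorem abs_deriv_kA_le {s : ℝ} (hs : 1 / 2 ≤ s) (hs1 : s ≤ 1) : |deriv (kA (3 / 4)) s| ≤ 4 := by
  have _ := hs1
  have hs0 : 0 < s := by linarith
  rw [deriv_kA_val hs0]
  have h1 : s ^ (-(3 / 4 : ℝ)) ≤ 2 := by
    have h2 : s ^ (-(3 / 4 : ℝ)) ≤ (1 / 2 : ℝ) ^ (-(3 / 4 : ℝ)) :=
      Real.rpow_le_rpow_of_nonpos (by norm_num) hs (by norm_num)
    have h3 : (1 / 2 : ℝ) ^ (-(3 / 4 : ℝ)) ≤ (1 / 2 : ℝ) ^ (-(1 : ℝ)) :=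
      Real.rpow_le_rpow_of_exponent_ge (by norm_num) (by norm_num) (by norm_num)
    have h4 : (1 / 2 : ℝ) ^ (-(1 : ℝ)) = 2 := by
      rw [Real.rpow_neg (by norm_num), Real.rpow_one]; norm_num
    linarith
  have h0 : 0 ≤ s ^ (-(3 / 4 : ℝ)) := Real.rpow_nonneg hs0.le _
  have hb : 0 ≤ (3 / 4 : ℝ) * (1 - s) + s := by nlinarith
  rw [abs_div, abs_of_pos hs0, div_le_iff₀ hs0, abs_mul, abs_neg, abs_of_nonneg h0,
    abs_of_nonneg hb]
  nlinarith

/-- Values of `ρ = ρ_{3/4}`: `ρ(r) = r^{3/2} ≤ r²` for `r ≥ 1`, and `0 ≤ ρ(r)` for `r ≥ 0`. [folklore] -/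
theorem rhoA_le_sq {r : ℝ} (hr : 1 ≤ r) : rhoA (3 / 4) r ≤ r ^ 2 := by
  rw [rhoA, show (2 : ℝ) * (3 / 4) = 3 / 2 by norm_num]
  calc r ^ (3 / 2 : ℝ) ≤ r ^ (2 : ℝ) := Real.rpow_le_rpow_of_exponent_le hr (by norm_num)
    _ = r ^ 2 := by rw [← Real.rpow_natCast]; norm_num

/-- `0 ≤ ρ(r)` for `0 ≤ r`. [folklore] -/
theorem rhoA_nonneg {r : ℝ} (hr : 0 ≤ r) : 0 ≤ rhoA (3 / 4) r := Real.rpow_nonneg hr _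

/-- `0 ≤ ρ'(r) ≤ 3r/2 ≤ 2r` for `r ≥ 1` (`ρ' = (3/2) r^{1/2}`). [folklore] -/
theorem deriv_rhoA_le {r : ℝ} (hr : 1 ≤ r) :
    0 ≤ deriv (rhoA (3 / 4)) r ∧ deriv (rhoA (3 / 4)) r ≤ 2 * r := by
  rw [deriv_rhoA]
  dsimp only
  rw [show (2 : ℝ) * (3 / 4) - 1 = 1 / 2 by norm_num, show (2 : ℝ) * (3 / 4) = 3 / 2 by norm_num]
  have h0 : 0 ≤ r ^ (1 / 2 : ℝ) := Real.rpow_nonneg (by linarith) _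
  have h1 : r ^ (1 / 2 : ℝ) ≤ r := by
    calc r ^ (1 / 2 : ℝ) ≤ r ^ (1 : ℝ) := Real.rpow_le_rpow_of_exponent_le hr (by norm_num)
      _ = r := Real.rpow_one r
  constructor <;> nlinarith

/-- `|ρ''(r)| ≤ 1` for `r ≥ 1` (`ρ'' = (3/4) r^{-1/2}`). [folklore] -/
theorem abs_deriv2_rhoA_le {r : ℝ} (hr : 1 ≤ r) : |deriv^[2] (rhoA (3 / 4)) r| ≤ 1 := by
  rw [deriv2_rhoA]
  dsimp only
  rw [show (2 : ℝ) * (3 / 4) - 2 = -(1 / 2) by norm_num, show (2 : ℝ) * (3 / 4) = 3 / 2 by norm_num,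
    show (3 / 2 : ℝ) - 1 = 1 / 2 by norm_num]
  have h0 : 0 ≤ r ^ (-(1 / 2) : ℝ) := Real.rpow_nonneg (by linarith) _
  have h1 : r ^ (-(1 / 2) : ℝ) ≤ 1 := Real.rpow_le_one_of_one_le_of_nonpos hr (by norm_num)
  rw [abs_of_nonneg (by positivity)]
  nlinarith

/-- **The level-set function on `ℝ × ℝ`**: `T_K(s, r) = (k(s)ρ(r) - B)/B` is smooth on
`]0,∞[ × ]0,∞[`. [folklore] -/
theorem contDiffOn_levelFun (B : ℝ) :
    ContDiffOn ℝ (⊤ : ℕ∞) (fun w : ℝ × ℝ => (kA (3 / 4) w.1 * rhoA (3 / 4) w.2 - B) / B)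
      (Ioi (0 : ℝ) ×ˢ Ioi (0 : ℝ)) := by
  refine ((ContDiffOn.mul ?_ ?_).sub contDiffOn_const).div_const _
  · exact (contDiffOn_kA _).comp contDiffOn_fst fun w hw => hw.1
  · exact (contDiffOn_rhoA _).comp contDiffOn_snd fun w hw => hw.2

/-- Derivatives of the level-set function at a point of `]0,∞[²`:
`∂ₛT_K = k'(s)ρ(r)/B`, `∂ᵣT_K = k(s)ρ'(r)/B`, `∂ᵣᵣT_K = k(s)ρ''(r)/B`. [folklore] -/
theorem derivs_levelFun (B : ℝ) {w : ℝ × ℝ} (hw : w ∈ Ioi (0 : ℝ) ×ˢ Ioi (0 : ℝ)) :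
    dt (fun w : ℝ × ℝ => (kA (3 / 4) w.1 * rhoA (3 / 4) w.2 - B) / B) w =
        deriv (kA (3 / 4)) w.1 * rhoA (3 / 4) w.2 / B ∧
      dx (1 : ℝ) (fun w : ℝ × ℝ => (kA (3 / 4) w.1 * rhoA (3 / 4) w.2 - B) / B) w =
        kA (3 / 4) w.1 * deriv (rhoA (3 / 4)) w.2 / B ∧
      dx (1 : ℝ) (dx (1 : ℝ) fun w : ℝ × ℝ => (kA (3 / 4) w.1 * rhoA (3 / 4) w.2 - B) / B) w =
        kA (3 / 4) w.1 * deriv^[2] (rhoA (3 / 4)) w.2 / B := by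
  set Ω : Set (ℝ × ℝ) := Ioi (0 : ℝ) ×ˢ Ioi (0 : ℝ) with hΩ
  have hΩo : IsOpen Ω := isOpen_Ioi.prod isOpen_Ioi
  -- the product `k(s) ρ(r)` and its derivatives on `Ω`
  set Pf : ℝ × ℝ → ℝ := fun w => kA (3 / 4) w.1 * rhoA (3 / 4) w.2 with hPf
  have hk : ∀ w ∈ Ω, DifferentiableAt ℝ (fun w : ℝ × ℝ => kA (3 / 4) w.1) w := fun w hw =>
    (((contDiffOn_kA _).differentiableOn (by simp)).differentiableAt (isOpen_Ioi.mem_nhds hw.1)).comp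
      w differentiableAt_fst
  have hρ : ∀ w ∈ Ω, DifferentiableAt ℝ (fun w : ℝ × ℝ => rhoA (3 / 4) w.2) w := fun w hw =>
    (((contDiffOn_rhoA _).differentiableOn (by simp)).differentiableAt (isOpen_Ioi.mem_nhds hw.2)).comp
      w differentiableAt_snd
  have hkd : ∀ w ∈ Ω, DifferentiableAt ℝ (kA (3 / 4)) w.1 := fun w hw =>
    ((contDiffOn_kA _).differentiableOn (by simp)).differentiableAt (isOpen_Ioi.mem_nhds hw.1)
  have hρd : ∀ w ∈ Ω, DifferentiableAt ℝ (rhoA (3 / 4)) w.2 := fun w hw =>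
    ((contDiffOn_rhoA _).differentiableOn (by simp)).differentiableAt (isOpen_Ioi.mem_nhds hw.2)
  -- `dt (k ∘ fst) = k'`, `dx 1 (k ∘ fst) = 0`, `dt (ρ ∘ snd) = 0`, `dx 1 (ρ ∘ snd) = ρ'`
  have e1 : ∀ w ∈ Ω, dt (fun w : ℝ × ℝ => kA (3 / 4) w.1) w = deriv (kA (3 / 4)) w.1 := by
    intro w hw; rw [dt_apply, fderiv_comp_fst_apply' (hkd w hw)]; simp
  have e2 : ∀ w ∈ Ω, dx (1 : ℝ) (fun w : ℝ × ℝ => kA (3 / 4) w.1) w = 0 := by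
    intro w hw; rw [dx_apply, fderiv_comp_fst_apply' (hkd w hw)]; simp
  have e3 : ∀ w ∈ Ω, dt (fun w : ℝ × ℝ => rhoA (3 / 4) w.2) w = 0 := fun w hw =>
    dt_sndProfile (hρd w hw)
  have e4 : ∀ w ∈ Ω, dx (1 : ℝ) (fun w : ℝ × ℝ => rhoA (3 / 4) w.2) w = deriv (rhoA (3 / 4)) w.2 :=
    fun w hw => dx_sndProfile (hρd w hw)
  have hPt : ∀ w ∈ Ω, dt Pf w = deriv (kA (3 / 4)) w.1 * rhoA (3 / 4) w.2 := by
    intro w hw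
    rw [hPf, dt_mul (hk w hw) (hρ w hw), e1 w hw, e3 w hw]; ring
  have hPx : ∀ w ∈ Ω, dx (1 : ℝ) Pf w = kA (3 / 4) w.1 * deriv (rhoA (3 / 4)) w.2 := by
    intro w hw
    rw [hPf, dx_mul (hk w hw) (hρ w hw), e2 w hw, e4 w hw]; ring
  -- the affine map `u ↦ (u - B)/B`
  have hTK : (fun w : ℝ × ℝ => (kA (3 / 4) w.1 * rhoA (3 / 4) w.2 - B) / B) =
      fun w => (fun u : ℝ => (u - B) / B) (Pf w) := rfl
  have hlin : ∀ u, deriv (fun u : ℝ => (u - B) / B) u = 1 / B := fun u => by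
    have h : HasDerivAt (fun u : ℝ => (u - B) / B) (1 / B) u := by
      simpa using ((hasDerivAt_id u).sub_const B).div_const B
    exact h.deriv
  have hlind : Differentiable ℝ fun u : ℝ => (u - B) / B := by fun_prop
  have hPfd : ∀ w ∈ Ω, DifferentiableAt ℝ Pf w := fun w hw => (hk w hw).mul (hρ w hw)
  refine ⟨?_, ?_, ?_⟩
  · rw [hTK, dt_comp_scalar (hlind _) (hPfd w hw), hlin, hPt w hw]; ring
  · rw [hTK, dx_comp_scalar (hlind _) (hPfd w hw), hlin, hPx w hw]; ring
  · -- second derivative in `r`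
    have hev : dx (1 : ℝ) (fun w : ℝ × ℝ => (kA (3 / 4) w.1 * rhoA (3 / 4) w.2 - B) / B) =ᶠ[𝓝 w]
        fun w => (1 / B) * (kA (3 / 4) w.1 * deriv (rhoA (3 / 4)) w.2) := by
      filter_upwards [hΩo.mem_nhds hw] with w' hw'
      rw [hTK, dx_comp_scalar (hlind _) (hPfd w' hw'), hlin, hPx w' hw']
    rw [dx_apply, hev.fderiv_eq]
    have hρ1 : ContDiffOn ℝ 1 (deriv (rhoA (3 / 4))) (Ioi 0) := by
      have h2 : ContDiffOn ℝ 2 (rhoA (3 / 4)) (Ioi 0) := (contDiffOn_rhoA (3 / 4)).of_le (by norm_cast)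
      exact h2.deriv_of_isOpen isOpen_Ioi (by norm_cast)
    have hρ'd : DifferentiableAt ℝ (deriv (rhoA (3 / 4))) w.2 :=
      (hρ1.differentiableOn one_ne_zero).differentiableAt (isOpen_Ioi.mem_nhds hw.2)
    have hd2 : DifferentiableAt ℝ (fun w : ℝ × ℝ => deriv (rhoA (3 / 4)) w.2) w :=
      hρ'd.comp w differentiableAt_snd
    have hd3 : DifferentiableAt ℝ (fun w : ℝ × ℝ => kA (3 / 4) w.1 * deriv (rhoA (3 / 4)) w.2) w :=
      (hk w hw).mul hd2
    rw [fderiv_const_mul hd3]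
    simp only [FunLike.coe_smul, Pi.smul_apply, smul_eq_mul]
    rw [← dx_apply, dx_mul (hk w hw) hd2, e2 w hw, dx_sndProfile hρ'd]
    simp only [Function.iterate_succ, Function.iterate_zero, Function.comp_apply, id_eq]
    ring

end LevelSet

/-! ### The level-set cut-off `m = ψ₂(K(s, ⟪y, e⟫))` (Seregin 2014, the factor `ψ₂(φ_B/B)`) -/

section LevelCutoff

variable {E : Type*} [NormedAddCommGroup E] [InnerProductSpace ℝ E] [FiniteDimensional ℝ E]

/-- **The level-set cut-off of Lemma A.3.** There is an absolute constant `C ≥ 0` such that for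
every unit vector `e` and every `B ≥ 1` there is `m : ℝ × E → ℝ`
(`m(s, y) = ψ₂((k(s)ρ(⟪y,e⟫) - B)/B)`, `k = k_{3/4}`, `ρ = ρ_{3/4}`, `ψ₂` the smooth step from
`-3/4` to `-1/2`; Seregin 2014, p. 213: `ψ₂(φ_B/B)`) which is smooth on
`Ω₊ = {s > 0} × {⟪y, e⟫ > 0}`, takes values in `[0, 1]`, equals `0` where `k ρ ≤ B/4` and `1`
where `k ρ ≥ B/2`, has `∂ₛm = ∇m = Δm = 0` where `k ρ ∉ [B/4, B/2]`, and satisfies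
`|∂ₛm|, |∇m|², |Δm| ≤ C ⟪y, e⟫²` at points of `Ω₊` with `1/2 ≤ s ≤ 1`, `⟪y, e⟫ ≥ 1`. [cite: Seregin2014, App. A.3, proof of Lemma A.3] -/
theorem exists_levelset_cutoff : ∃ C : ℝ, 0 ≤ C ∧ ∀ (e : E), ‖e‖ = 1 → ∀ (B : ℝ), 1 ≤ B →
    ∃ m : ℝ × E → ℝ,
      ContDiffOn ℝ (⊤ : ℕ∞) m {z : ℝ × E | 0 < z.1 ∧ 0 < ⟪z.2, e⟫} ∧
      (∀ z, 0 ≤ m z) ∧ (∀ z, m z ≤ 1) ∧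
      (∀ z : ℝ × E, 0 < z.1 → 0 < ⟪z.2, e⟫ →
        kA (3 / 4) z.1 * rhoA (3 / 4) ⟪z.2, e⟫ ≤ B / 4 → m z = 0) ∧
      (∀ z : ℝ × E, 0 < z.1 → 0 < ⟪z.2, e⟫ →
        B / 2 ≤ kA (3 / 4) z.1 * rhoA (3 / 4) ⟪z.2, e⟫ → m z = 1) ∧
      (∀ z : ℝ × E, 0 < z.1 → 0 < ⟪z.2, e⟫ →
        kA (3 / 4) z.1 * rhoA (3 / 4) ⟪z.2, e⟫ ∉ Icc (B / 4) (B / 2) →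
        dt m z = 0 ∧ gradSq m z = 0 ∧ lap m z = 0) ∧
      (∀ z : ℝ × E, 1 / 2 ≤ z.1 → z.1 ≤ 1 → 1 ≤ ⟪z.2, e⟫ →
        |dt m z| ≤ C * ⟪z.2, e⟫ ^ 2 ∧ gradSq m z ≤ C * ⟪z.2, e⟫ ^ 2 ∧
          |lap m z| ≤ C * ⟪z.2, e⟫ ^ 2) := by
  obtain ⟨D₁, D₂, hD₁, hD₂, hstep⟩ := exists_smooth_step
  refine ⟨64 * D₁ ^ 2 + 64 * D₂ + 16 * D₁ + 1, by positivity, fun e he B hB => ?_⟩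
  obtain ⟨ψ, hψ, hψ0, hψ1, hψnn, hψle, hψ', hψ'', hψ'0, hψ''0⟩ :=
    hstep (-(3 / 4) : ℝ) (-(1 / 2)) (by norm_num)
  have hw14 : (-(1 / 2) : ℝ) - -(3 / 4) = 1 / 4 := by norm_num
  rw [hw14] at hψ' hψ''
  -- the level function and the cut-off
  set TK : ℝ × ℝ → ℝ := fun w => (kA (3 / 4) w.1 * rhoA (3 / 4) w.2 - B) / B with hTK
  set Ω₂ : Set (ℝ × ℝ) := Ioi (0 : ℝ) ×ˢ Ioi (0 : ℝ) with hΩ₂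
  have hΩ₂o : IsOpen Ω₂ := isOpen_Ioi.prod isOpen_Ioi
  have hTKs : ContDiffOn ℝ (⊤ : ℕ∞) TK Ω₂ := contDiffOn_levelFun B
  have hTK2 : ContDiffOn ℝ 2 TK Ω₂ := hTKs.of_le (by norm_cast)
  set Ω : Set (ℝ × E) := {z : ℝ × E | 0 < z.1 ∧ 0 < ⟪z.2, e⟫} with hΩ
  have hΩo : IsOpen Ω := (isOpen_lt continuous_const continuous_fst).and
    (isOpen_lt continuous_const (continuous_snd.inner continuous_const))
  set K : ℝ × E → ℝ := fun z => TK (z.1, ⟪z.2, e⟫) with hK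
  set m : ℝ × E → ℝ := fun z => ψ (K z) with hm
  have hπΩ : ∀ z ∈ Ω, ((z.1, ⟪z.2, e⟫) : ℝ × ℝ) ∈ Ω₂ := fun z hz => ⟨hz.1, hz.2⟩
  have hKs : ContDiffOn ℝ (⊤ : ℕ∞) K Ω :=
    hTKs.comp (contDiff_pairInner e).contDiffOn fun z hz => hπΩ z hz
  have hK2 : ContDiffOn ℝ 2 K Ω := hKs.of_le (by norm_cast)
  have hms : ContDiffOn ℝ (⊤ : ℕ∞) m Ω := hψ.comp_contDiffOn hKs
  have hψd : Differentiable ℝ ψ := hψ.differentiable (by simp)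
  have hψ2 : ContDiff ℝ 2 ψ := hψ.of_le (by norm_cast)
  have hTKd : ∀ w ∈ Ω₂, DifferentiableAt ℝ TK w := fun w hw =>
    (hTKs.differentiableOn (by simp)).differentiableAt (hΩ₂o.mem_nhds hw)
  have hKd : ∀ z ∈ Ω, DifferentiableAt ℝ K z := fun z hz =>
    (hKs.differentiableOn (by simp)).differentiableAt (hΩo.mem_nhds hz)
  -- the derivative formulas at `z ∈ Ω`
  have hKval : ∀ z, K z = (kA (3 / 4) z.1 * rhoA (3 / 4) ⟪z.2, e⟫ - B) / B := fun z => rfl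
  have hdtK : ∀ z ∈ Ω, dt K z = deriv (kA (3 / 4)) z.1 * rhoA (3 / 4) ⟪z.2, e⟫ / B := by
    intro z hz
    rw [hK, dt_comp_pairInner (hTKd _ (hπΩ z hz)), (derivs_levelFun B (hπΩ z hz)).1]
  have hgK : ∀ z ∈ Ω, gradSq K z = (kA (3 / 4) z.1 * deriv (rhoA (3 / 4)) ⟪z.2, e⟫ / B) ^ 2 := by
    intro z hz
    rw [hK, gradSq_comp_pairInner he (hTKd _ (hπΩ z hz)), (derivs_levelFun B (hπΩ z hz)).2.1]
  have hlapK : ∀ z ∈ Ω, lap K z = kA (3 / 4) z.1 * deriv^[2] (rhoA (3 / 4)) ⟪z.2, e⟫ / B := by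
    intro z hz
    rw [hK, lap_comp_pairInner he hΩ₂o hTK2 (hπΩ z hz), (derivs_levelFun B (hπΩ z hz)).2.2]
  have hdtm : ∀ z ∈ Ω, dt m z = deriv ψ (K z) * dt K z := fun z hz =>
    dt_comp_scalar (hψd _) (hKd z hz)
  have hgm : ∀ z ∈ Ω, gradSq m z = deriv ψ (K z) ^ 2 * gradSq K z := fun z hz =>
    gradSq_comp_scalar (hψd _) (hKd z hz)
  have hlapm : ∀ z ∈ Ω, lap m z = deriv (deriv ψ) (K z) * gradSq K z + deriv ψ (K z) * lap K z :=
    fun z hz => lap_comp_scalar hΩo hz hψ2 hK2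
  have hB0 : 0 < B := by linarith
  refine ⟨m, hms, fun z => hψnn _, fun z => hψle _, ?_, ?_, ?_, ?_⟩
  · -- `m = 0` where `kρ ≤ B/4`
    intro z hz1 hz2 hle
    apply hψ0
    rw [hKval, div_le_iff₀ hB0]; linarith
  · -- `m = 1` where `kρ ≥ B/2`
    intro z hz1 hz2 hge
    apply hψ1
    rw [hKval, le_div_iff₀ hB0]; linarith
  · -- derivatives vanish off the transition set
    intro z hz1 hz2 hnot
    have hz : z ∈ Ω := ⟨hz1, hz2⟩
    have hKout : K z < -(3 / 4) ∨ -(1 / 2) < K z := by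
      simp only [mem_Icc, not_and_or, not_le] at hnot
      rcases hnot with h | h
      · left
        rw [hKval, div_lt_iff₀ hB0]; linarith
      · right
        rw [hKval, lt_div_iff₀ hB0]; linarith
    have h1 : deriv ψ (K z) = 0 := hψ'0 _ hKout
    have h2 : deriv (deriv ψ) (K z) = 0 := hψ''0 _ hKout
    refine ⟨?_, ?_, ?_⟩
    · rw [hdtm z hz, h1, zero_mul]
    · rw [hgm z hz, h1]; ring
    · rw [hlapm z hz, h1, h2]; ring
  · -- the bounds
    intro z hz1 hz2 hr
    have hz : z ∈ Ω := ⟨by linarith, by linarith⟩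
    set r : ℝ := ⟪z.2, e⟫ with hr'
    obtain ⟨hk0, hk1⟩ := kA_mem_Icc hz1 hz2
    have hk' := abs_deriv_kA_le hz1 hz2
    have hρ := rhoA_le_sq hr
    have hρ0 : 0 ≤ rhoA (3 / 4) r := rhoA_nonneg (by linarith)
    obtain ⟨hρ'0, hρ'⟩ := deriv_rhoA_le hr
    have hρ'' := abs_deriv2_rhoA_le hr
    have hψ'b : |deriv ψ (K z)| ≤ 4 * D₁ := (hψ' _).trans (le_of_eq (by norm_num; ring))
    have hψ''b : |deriv (deriv ψ) (K z)| ≤ 16 * D₂ := (hψ'' _).trans (le_of_eq (by norm_num; ring))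
    have hr1 : 1 ≤ r ^ 2 := by nlinarith
    have hBinv : 1 / B ≤ 1 := by rw [div_le_one hB0]; exact hB
    -- `|∂ₛK| ≤ 4 r²`, `|∇K|² ≤ 4 r²`, `|ΔK| ≤ 1`
    have hdtKb : |dt K z| ≤ 4 * r ^ 2 := by
      rw [hdtK z hz, abs_div, abs_of_pos hB0, div_le_iff₀ hB0, abs_mul, abs_of_nonneg hρ0]
      calc |deriv (kA (3 / 4)) z.1| * rhoA (3 / 4) r ≤ 4 * r ^ 2 := by
            exact mul_le_mul hk' hρ hρ0 (by norm_num)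
        _ ≤ 4 * r ^ 2 * B := by nlinarith
    have hgKb : gradSq K z ≤ 4 * r ^ 2 := by
      rw [hgK z hz, div_pow, div_le_iff₀ (by positivity)]
      have h1 : 0 ≤ kA (3 / 4) z.1 * deriv (rhoA (3 / 4)) r := mul_nonneg hk0 hρ'0
      have h2 : kA (3 / 4) z.1 * deriv (rhoA (3 / 4)) r ≤ 2 * r := by nlinarith
      have h3 : (kA (3 / 4) z.1 * deriv (rhoA (3 / 4)) r) ^ 2 ≤ (2 * r) ^ 2 :=
        pow_le_pow_left₀ h1 h2 2
      have hB2 : 1 ≤ B ^ 2 := by nlinarith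
      nlinarith
    have hlapKb : |lap K z| ≤ 1 := by
      rw [hlapK z hz, abs_div, abs_of_pos hB0, div_le_iff₀ hB0, abs_mul, abs_of_nonneg hk0]
      nlinarith [abs_nonneg (deriv^[2] (rhoA (3 / 4)) r)]
    refine ⟨?_, ?_, ?_⟩
    · rw [hdtm z hz, abs_mul]
      calc |deriv ψ (K z)| * |dt K z| ≤ 4 * D₁ * (4 * r ^ 2) :=
            mul_le_mul hψ'b hdtKb (abs_nonneg _) (by positivity)
        _ ≤ (64 * D₁ ^ 2 + 64 * D₂ + 16 * D₁ + 1) * r ^ 2 := by nlinarith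
    · rw [hgm z hz]
      have h1 : deriv ψ (K z) ^ 2 ≤ (4 * D₁) ^ 2 := by
        rw [← sq_abs]; exact pow_le_pow_left₀ (abs_nonneg _) hψ'b 2
      calc deriv ψ (K z) ^ 2 * gradSq K z ≤ (4 * D₁) ^ 2 * (4 * r ^ 2) :=
            mul_le_mul h1 hgKb (gradSq_nonneg K z) (by positivity)
        _ ≤ (64 * D₁ ^ 2 + 64 * D₂ + 16 * D₁ + 1) * r ^ 2 := by nlinarith
    · rw [hlapm z hz]
      calc |deriv (deriv ψ) (K z) * gradSq K z + deriv ψ (K z) * lap K z|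
          ≤ |deriv (deriv ψ) (K z)| * gradSq K z + |deriv ψ (K z)| * |lap K z| := by
            refine (abs_add_le _ _).trans (add_le_add ?_ ?_)
            · rw [abs_mul, abs_of_nonneg (gradSq_nonneg K z)]
            · rw [abs_mul]
        _ ≤ 16 * D₂ * (4 * r ^ 2) + 4 * D₁ * 1 :=
            add_le_add (mul_le_mul hψ''b hgKb (gradSq_nonneg K z) (by positivity))
              (mul_le_mul hψ'b hlapKb (abs_nonneg _) (by positivity))
        _ ≤ (64 * D₁ ^ 2 + 64 * D₂ + 16 * D₁ + 1) * r ^ 2 := by nlinarith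

end LevelCutoff

/-! ### The cut-off in `yₙ = ⟪y, e⟫` (Seregin's `ψ₁`, and the cut-off at large `yₙ`) -/

section YnCutoff

variable {E : Type*} [NormedAddCommGroup E] [InnerProductSpace ℝ E] [FiniteDimensional ℝ E]

/-- **The cut-off in the normal coordinate.** There is an absolute `C ≥ 0` such that for every
unit vector `e` and `R'' ≥ 2` there is a smooth `Ψ : ℝ × E → ℝ` (a function of `⟪y, e⟫` only:
`Ψ = ψ₀(⟪y,e⟫)(1 - ψ₄(⟪y,e⟫))`, `ψ₀` the step from `1/2` to `1`, `ψ₄` the step from `R''` to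
`R'' + 1`) with values in `[0, 1]`, `Ψ = 1` where `1 ≤ ⟪y, e⟫ ≤ R''`, `Ψ = 0` where
`⟪y, e⟫ ≤ 1/2` or `⟪y, e⟫ ≥ R'' + 1`, `∂ₛΨ = 0`, `|∇Ψ|² ≤ C`, `|ΔΨ| ≤ C`, and `∇Ψ = 0`, `ΔΨ = 0`
unless `⟪y, e⟫ ∈ [1/2, 1] ∪ [R'', R'' + 1]`. [folklore] -/
theorem exists_yn_cutoff : ∃ C : ℝ, 0 ≤ C ∧ ∀ (e : E), ‖e‖ = 1 → ∀ (R'' : ℝ), 2 ≤ R'' →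
    ∃ Ψ : ℝ × E → ℝ, ContDiff ℝ (⊤ : ℕ∞) Ψ ∧ (∀ z, 0 ≤ Ψ z) ∧ (∀ z, Ψ z ≤ 1) ∧
      (∀ z : ℝ × E, 1 ≤ ⟪z.2, e⟫ → ⟪z.2, e⟫ ≤ R'' → Ψ z = 1) ∧
      (∀ z : ℝ × E, ⟪z.2, e⟫ ≤ 1 / 2 → Ψ z = 0) ∧
      (∀ z : ℝ × E, R'' + 1 ≤ ⟪z.2, e⟫ → Ψ z = 0) ∧
      (∀ z, dt Ψ z = 0) ∧ (∀ z, gradSq Ψ z ≤ C) ∧ (∀ z, |lap Ψ z| ≤ C) ∧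
      (∀ z : ℝ × E, ⟪z.2, e⟫ ∉ Icc (1 / 2 : ℝ) 1 ∪ Icc R'' (R'' + 1) →
        gradSq Ψ z = 0 ∧ lap Ψ z = 0) := by
  obtain ⟨D₁, D₂, hD₁, hD₂, hstep⟩ := exists_smooth_step
  refine ⟨9 * D₁ ^ 2 + 5 * D₂ + 4 * D₁ ^ 2 + 1, by positivity, fun e he R'' hR'' => ?_⟩
  obtain ⟨ψ₀, hψ₀, hψ₀0, hψ₀1, hψ₀nn, hψ₀le, hψ₀', hψ₀'', hψ₀'0, hψ₀''0⟩ :=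
    hstep (1 / 2 : ℝ) 1 (by norm_num)
  obtain ⟨ψ₄, hψ₄, hψ₄0, hψ₄1, hψ₄nn, hψ₄le, hψ₄', hψ₄'', hψ₄'0, hψ₄''0⟩ :=
    hstep R'' (R'' + 1) (by linarith)
  rw [show (1 : ℝ) - 1 / 2 = 1 / 2 by norm_num] at hψ₀' hψ₀''
  rw [show R'' + 1 - R'' = 1 by ring] at hψ₄' hψ₄''
  -- the one-variable profile and its derivatives
  set g : ℝ → ℝ := fun r => ψ₀ r * (1 - ψ₄ r) with hg
  have hgs : ContDiff ℝ (⊤ : ℕ∞) g := hψ₀.mul (contDiff_const.sub hψ₄)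
  have hg2 : ContDiff ℝ 2 g := hgs.of_le (by norm_cast)
  have hψ₀d : Differentiable ℝ ψ₀ := hψ₀.differentiable (by simp)
  have hψ₄d : Differentiable ℝ ψ₄ := hψ₄.differentiable (by simp)
  have hgd : Differentiable ℝ g := hgs.differentiable (by simp)
  have hg' : ∀ r, deriv g r = deriv ψ₀ r * (1 - ψ₄ r) - ψ₀ r * deriv ψ₄ r := by
    intro r
    have h : HasDerivAt g (deriv ψ₀ r * (1 - ψ₄ r) + ψ₀ r * -deriv ψ₄ r) r :=
      (hψ₀d r).hasDerivAt.fun_mul ((hψ₄d r).hasDerivAt.const_sub 1)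
    rw [h.deriv]; ring
  have hψ₀1d : Differentiable ℝ (deriv ψ₀) := by
    have : ContDiff ℝ (⊤ : ℕ∞) (deriv ψ₀) := by simpa using hψ₀.iterate_deriv 1
    exact this.differentiable (by simp)
  have hψ₄1d : Differentiable ℝ (deriv ψ₄) := by
    have : ContDiff ℝ (⊤ : ℕ∞) (deriv ψ₄) := by simpa using hψ₄.iterate_deriv 1
    exact this.differentiable (by simp)
  have hg'' : ∀ r, deriv (deriv g) r = deriv (deriv ψ₀) r * (1 - ψ₄ r) -
      2 * (deriv ψ₀ r * deriv ψ₄ r) - ψ₀ r * deriv (deriv ψ₄) r := by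
    intro r
    have e : deriv g = fun r => deriv ψ₀ r * (1 - ψ₄ r) - ψ₀ r * deriv ψ₄ r := funext hg'
    rw [e]
    have h : HasDerivAt (fun r => deriv ψ₀ r * (1 - ψ₄ r) - ψ₀ r * deriv ψ₄ r)
        (deriv (deriv ψ₀) r * (1 - ψ₄ r) + deriv ψ₀ r * -deriv ψ₄ r -
          (deriv ψ₀ r * deriv ψ₄ r + ψ₀ r * deriv (deriv ψ₄) r)) r :=
      ((hψ₀1d r).hasDerivAt.fun_mul ((hψ₄d r).hasDerivAt.const_sub 1)).sub
        ((hψ₀d r).hasDerivAt.fun_mul (hψ₄1d r).hasDerivAt)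
    rw [h.deriv]; ring
  -- bounds on the profile
  have hgb' : ∀ r, |deriv g r| ≤ 3 * D₁ := by
    intro r
    rw [hg']
    have h1 : |deriv ψ₀ r * (1 - ψ₄ r)| ≤ 2 * D₁ := by
      rw [abs_mul]
      calc |deriv ψ₀ r| * |1 - ψ₄ r| ≤ D₁ / (1 / 2) * 1 := by
            refine mul_le_mul (hψ₀' r) ?_ (abs_nonneg _) (by positivity)
            rw [abs_le]; exact ⟨by linarith [hψ₄le r], by linarith [hψ₄nn r]⟩
        _ = 2 * D₁ := by ring
    have h2 : |ψ₀ r * deriv ψ₄ r| ≤ D₁ := by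
      rw [abs_mul]
      calc |ψ₀ r| * |deriv ψ₄ r| ≤ 1 * (D₁ / 1) := by
            refine mul_le_mul ?_ (hψ₄' r) (abs_nonneg _) zero_le_one
            rw [abs_le]; exact ⟨by linarith [hψ₀nn r], hψ₀le r⟩
        _ = D₁ := by ring
    calc |deriv ψ₀ r * (1 - ψ₄ r) - ψ₀ r * deriv ψ₄ r| ≤ 2 * D₁ + D₁ :=
          (abs_sub _ _).trans (add_le_add h1 h2)
      _ = 3 * D₁ := by ring
  have hgb'' : ∀ r, |deriv (deriv g) r| ≤ 5 * D₂ + 4 * D₁ ^ 2 := by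
    intro r
    rw [hg'']
    have h1 : |deriv (deriv ψ₀) r * (1 - ψ₄ r)| ≤ 4 * D₂ := by
      rw [abs_mul]
      calc |deriv (deriv ψ₀) r| * |1 - ψ₄ r| ≤ D₂ / (1 / 2) ^ 2 * 1 := by
            refine mul_le_mul (hψ₀'' r) ?_ (abs_nonneg _) (by positivity)
            rw [abs_le]; exact ⟨by linarith [hψ₄le r], by linarith [hψ₄nn r]⟩
        _ = 4 * D₂ := by ring
    have h2 : |2 * (deriv ψ₀ r * deriv ψ₄ r)| ≤ 4 * D₁ ^ 2 := by
      rw [abs_mul, abs_mul, abs_two]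
      have h3 : |deriv ψ₀ r| * |deriv ψ₄ r| ≤ D₁ / (1 / 2) * (D₁ / 1) :=
        mul_le_mul (hψ₀' r) (hψ₄' r) (abs_nonneg _) (by positivity)
      calc 2 * (|deriv ψ₀ r| * |deriv ψ₄ r|) ≤ 2 * (D₁ / (1 / 2) * (D₁ / 1)) := by linarith
        _ = 4 * D₁ ^ 2 := by ring
    have h3 : |ψ₀ r * deriv (deriv ψ₄) r| ≤ D₂ := by
      rw [abs_mul]
      calc |ψ₀ r| * |deriv (deriv ψ₄) r| ≤ 1 * (D₂ / 1 ^ 2) := by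
            refine mul_le_mul ?_ (hψ₄'' r) (abs_nonneg _) zero_le_one
            rw [abs_le]; exact ⟨by linarith [hψ₀nn r], hψ₀le r⟩
        _ = D₂ := by ring
    calc |deriv (deriv ψ₀) r * (1 - ψ₄ r) - 2 * (deriv ψ₀ r * deriv ψ₄ r) -
          ψ₀ r * deriv (deriv ψ₄) r| ≤ 4 * D₂ + 4 * D₁ ^ 2 + D₂ := by
          refine (abs_sub _ _).trans (add_le_add ((abs_sub _ _).trans (add_le_add h1 h2)) h3)
      _ = 5 * D₂ + 4 * D₁ ^ 2 := by ring
  -- vanishing of the derivatives off `[1/2, 1] ∪ [R'', R''+1]`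
  have hg'0 : ∀ r, r ∉ Icc (1 / 2 : ℝ) 1 ∪ Icc R'' (R'' + 1) → deriv g r = 0 ∧ deriv (deriv g) r = 0 := by
    intro r hr
    simp only [mem_union, mem_Icc, not_or, not_and_or, not_le] at hr
    have h0 : deriv ψ₀ r = 0 := hψ₀'0 r (by rcases hr.1 with h | h <;> [left; right] <;> linarith)
    have h0' : deriv (deriv ψ₀) r = 0 := hψ₀''0 r (by rcases hr.1 with h | h <;> [left; right] <;> linarith)
    have h4 : deriv ψ₄ r = 0 := hψ₄'0 r (by rcases hr.2 with h | h <;> [left; right] <;> linarith)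
    have h4' : deriv (deriv ψ₄) r = 0 := hψ₄''0 r (by rcases hr.2 with h | h <;> [left; right] <;> linarith)
    rw [hg', hg'', h0, h0', h4, h4']
    constructor <;> ring
  -- the space–time function `Ψ(s, y) = g(⟪y, e⟫)`
  set T : ℝ × ℝ → ℝ := fun w => g w.2 with hT
  have hTs : ContDiff ℝ (⊤ : ℕ∞) T := hgs.comp contDiff_snd
  have hT2 : ContDiff ℝ 2 T := hTs.of_le (by norm_cast)
  have hTd : Differentiable ℝ T := hTs.differentiable (by simp)
  have hdxT : ∀ w, dx (1 : ℝ) T w = deriv g w.2 := fun w => dx_sndProfile (hgd _)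
  have hdxdxT : ∀ w, dx (1 : ℝ) (dx (1 : ℝ) T) w = deriv (deriv g) w.2 := fun w =>
    dx_dx_sndProfile hg2 w
  set Ψ : ℝ × E → ℝ := fun z => T (z.1, ⟪z.2, e⟫) with hΨ
  have hΨs : ContDiff ℝ (⊤ : ℕ∞) Ψ := hTs.comp (contDiff_pairInner e)
  have hΨval : ∀ z, Ψ z = ψ₀ ⟪z.2, e⟫ * (1 - ψ₄ ⟪z.2, e⟫) := fun z => rfl
  have hdtΨ : ∀ z, dt Ψ z = 0 := fun z => by
    rw [hΨ, dt_comp_pairInner (hTd _), hT, dt_sndProfile (hgd _)]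
  have hgΨ : ∀ z, gradSq Ψ z = deriv g ⟪z.2, e⟫ ^ 2 := fun z => by
    rw [hΨ, gradSq_comp_pairInner he (hTd _), hdxT]
  have hlapΨ : ∀ z, lap Ψ z = deriv (deriv g) ⟪z.2, e⟫ := fun z => by
    rw [hΨ, lap_comp_pairInner he isOpen_univ hT2.contDiffOn (mem_univ _), hdxdxT]
  refine ⟨Ψ, hΨs, fun z => mul_nonneg (hψ₀nn _) (by linarith [hψ₄le ⟪z.2, e⟫]),
    fun z => ?_, ?_, ?_, ?_, hdtΨ, fun z => ?_, fun z => ?_, fun z hz => ?_⟩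
  · rw [hΨval]
    have := hψ₀le ⟪z.2, e⟫; have := hψ₀nn ⟪z.2, e⟫; have := hψ₄nn ⟪z.2, e⟫
    nlinarith [hψ₄le ⟪z.2, e⟫]
  · intro z h1 h2
    rw [hΨval, hψ₀1 _ h1, hψ₄0 _ h2]; ring
  · intro z h
    rw [hΨval, hψ₀0 _ h]; ring
  · intro z h
    rw [hΨval, hψ₄1 _ h]; ring
  · rw [hgΨ]
    have h1 : deriv g ⟪z.2, e⟫ ^ 2 ≤ (3 * D₁) ^ 2 := by
      rw [← sq_abs]; exact pow_le_pow_left₀ (abs_nonneg _) (hgb' _) 2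
    nlinarith
  · rw [hlapΨ]
    exact (hgb'' _).trans (by nlinarith)
  · rw [hgΨ, hlapΨ, (hg'0 _ hz).1, (hg'0 _ hz).2]
    simp

end YnCutoff

/-! ### The cut-off at large `|y'|` -/

section YPrimeCutoff

variable {E : Type*} [NormedAddCommGroup E] [InnerProductSpace ℝ E] [FiniteDimensional ℝ E]

/-- **The cut-off at large `|y'|`.** There is `C = C(dim E) ≥ 0` such that for every unit
vector `e` and `R' ≥ 1` there is a smooth `S : ℝ × E → ℝ` (`S = 1 - χ(|y'|²)`, `χ` the smooth
step from `R'²` to `(R'+1)²`, `|y'|² = ‖y‖² - ⟪y, e⟫²`) with values in `[0, 1]`, `S = 1` where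
`|y'|² ≤ R'²`, `S = 0` where `|y'|² ≥ (R'+1)²`, `∂ₛS = 0`, `|∇S|² ≤ C`, `|ΔS| ≤ C`, and
`∇S = 0`, `ΔS = 0` unless `|y'|² ∈ [R'², (R'+1)²]`. [folklore] -/
theorem exists_yprime_cutoff : ∃ C : ℝ, 0 ≤ C ∧ ∀ (e : E), ‖e‖ = 1 → ∀ (R' : ℝ), 1 ≤ R' →
    ∃ S : ℝ × E → ℝ, ContDiff ℝ (⊤ : ℕ∞) S ∧ (∀ z, 0 ≤ S z) ∧ (∀ z, S z ≤ 1) ∧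
      (∀ z : ℝ × E, ‖z.2‖ ^ 2 - ⟪z.2, e⟫ ^ 2 ≤ R' ^ 2 → S z = 1) ∧
      (∀ z : ℝ × E, (R' + 1) ^ 2 ≤ ‖z.2‖ ^ 2 - ⟪z.2, e⟫ ^ 2 → S z = 0) ∧
      (∀ z, dt S z = 0) ∧ (∀ z, gradSq S z ≤ C) ∧ (∀ z, |lap S z| ≤ C) ∧
      (∀ z : ℝ × E, ‖z.2‖ ^ 2 - ⟪z.2, e⟫ ^ 2 ∉ Icc (R' ^ 2) ((R' + 1) ^ 2) →
        gradSq S z = 0 ∧ lap S z = 0) := by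
  obtain ⟨D₁, D₂, hD₁, hD₂, hstep⟩ := exists_smooth_step
  set n : ℝ := (Module.finrank ℝ E : ℝ) with hn
  have hn0 : 0 ≤ n := Nat.cast_nonneg _
  refine ⟨4 * D₁ ^ 2 + 4 * D₂ + 2 * n * D₁ + 1, by positivity, fun e he R' hR' => ?_⟩
  have hw : R' ^ 2 < (R' + 1) ^ 2 := by nlinarith
  obtain ⟨χ, hχ, hχ0, hχ1, hχnn, hχle, hχ', hχ'', hχ'0, hχ''0⟩ := hstep (R' ^ 2) ((R' + 1) ^ 2) hw
  have hwd : (R' + 1) ^ 2 - R' ^ 2 = 2 * R' + 1 := by ring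
  rw [hwd] at hχ' hχ''
  have hw0 : 0 < 2 * R' + 1 := by linarith
  set G : ℝ × E → ℝ := fun z => ‖z.2‖ ^ 2 - ⟪z.2, e⟫ ^ 2 with hG
  have hGs : ContDiff ℝ (⊤ : ℕ∞) G := contDiff_normSq_sub_innerSq e
  have hG2 : ContDiff ℝ 2 G := hGs.of_le (by norm_cast)
  have hGd : Differentiable ℝ G := hGs.differentiable (by simp)
  set S : ℝ × E → ℝ := fun z => 1 - χ (G z) with hS
  have h1χd : Differentiable ℝ fun u => 1 - χ u := by
    have := hχ.differentiable (by simp); fun_prop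
  have h1χ2 : ContDiff ℝ 2 fun u => 1 - χ u := contDiff_const.sub (hχ.of_le (by norm_cast))
  have hSs : ContDiff ℝ (⊤ : ℕ∞) S := contDiff_const.sub (hχ.comp hGs)
  have hd1 : ∀ u, deriv (fun u => 1 - χ u) u = -deriv χ u := fun u => by simp [deriv_const_sub]
  have hd2 : ∀ u, deriv (deriv fun u => 1 - χ u) u = -deriv (deriv χ) u := fun u => by
    have : deriv (fun u => 1 - χ u) = fun u => -deriv χ u := funext hd1
    rw [this]; simp
  have hdtS : ∀ z, dt S z = 0 := fun z => by
    rw [hS, dt_comp_scalar (h1χd _) (hGd _), hG, dt_normSq_sub_innerSq, mul_zero]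
  have hgS : ∀ z, gradSq S z = deriv χ (G z) ^ 2 * (4 * G z) := fun z => by
    rw [hS, gradSq_comp_scalar (h1χd _) (hGd _), hd1, hG, gradSq_normSq_sub_innerSq he]
    ring
  have hlapS : ∀ z, lap S z = -(deriv (deriv χ) (G z) * (4 * G z) + deriv χ (G z) * (2 * (n - 1))) := by
    intro z
    rw [hS, lap_comp_scalar isOpen_univ (mem_univ z) h1χ2 hG2.contDiffOn, hd1, hd2, hG,
      gradSq_normSq_sub_innerSq he, lap_normSq_sub_innerSq he, ← hn]
    ring
  have hG0 : ∀ z, 0 ≤ G z := fun z => normSq_sub_innerSq_nonneg he z.2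
  -- on the transition set `G ≤ (R'+1)²`
  have hbound : ∀ z, deriv χ (G z) ≠ 0 ∨ deriv (deriv χ) (G z) ≠ 0 → G z ≤ (R' + 1) ^ 2 := by
    intro z h
    by_contra hc
    push Not at hc
    rcases h with h | h
    · exact h (hχ'0 _ (Or.inr hc))
    · exact h (hχ''0 _ (Or.inr hc))
  refine ⟨S, hSs, fun z => by simp only [hS]; linarith [hχle (G z)],
    fun z => by simp only [hS]; linarith [hχnn (G z)], fun z hz => ?_, fun z hz => ?_, hdtS,
    fun z => ?_, fun z => ?_, fun z hz => ?_⟩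
  · simp only [hS]; rw [hχ0 _ hz]; ring
  · simp only [hS]; rw [hχ1 _ hz]; ring
  · rw [hgS]
    by_cases h : deriv χ (G z) = 0
    · rw [h]; simp only [ne_eq, OfNat.ofNat_ne_zero, not_false_eq_true, zero_pow, zero_mul]
      positivity
    · have hGle := hbound z (Or.inl h)
      have h1 : deriv χ (G z) ^ 2 ≤ (D₁ / (2 * R' + 1)) ^ 2 := by
        rw [← sq_abs]; exact pow_le_pow_left₀ (abs_nonneg _) (hχ' _) 2
      have h2 : deriv χ (G z) ^ 2 * (4 * G z) ≤ (D₁ / (2 * R' + 1)) ^ 2 * (4 * (R' + 1) ^ 2) :=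
        mul_le_mul h1 (by linarith) (by linarith [hG0 z]) (sq_nonneg _)
      have h3 : (D₁ / (2 * R' + 1)) ^ 2 * (4 * (R' + 1) ^ 2) ≤ 4 * D₁ ^ 2 := by
        rw [div_pow, div_mul_eq_mul_div, div_le_iff₀ (by positivity)]
        nlinarith [sq_nonneg D₁, sq_nonneg R']
      linarith [h2, h3, sq_nonneg D₂, mul_nonneg hn0 hD₁]
  · rw [hlapS, abs_neg]
    by_cases h : deriv χ (G z) = 0 ∧ deriv (deriv χ) (G z) = 0
    · rw [h.1, h.2]; simp only [zero_mul, add_zero, abs_zero]; positivity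
    · have hGle : G z ≤ (R' + 1) ^ 2 := hbound z (by tauto)
      have h1 : |deriv (deriv χ) (G z) * (4 * G z)| ≤ 4 * D₂ := by
        rw [abs_mul, abs_of_nonneg (by linarith [hG0 z] : 0 ≤ 4 * G z)]
        calc |deriv (deriv χ) (G z)| * (4 * G z) ≤ D₂ / (2 * R' + 1) ^ 2 * (4 * (R' + 1) ^ 2) :=
              mul_le_mul (hχ'' _) (by linarith) (by linarith [hG0 z]) (by positivity)
          _ ≤ 4 * D₂ := by
              rw [div_mul_eq_mul_div, div_le_iff₀ (by positivity)]
              nlinarith [sq_nonneg R', hD₂]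
      have h2 : |deriv χ (G z) * (2 * (n - 1))| ≤ 2 * n * D₁ + 2 * D₁ := by
        rw [abs_mul]
        calc |deriv χ (G z)| * |2 * (n - 1)| ≤ D₁ / (2 * R' + 1) * (2 * n + 2) := by
              refine mul_le_mul (hχ' _) ?_ (abs_nonneg _) (by positivity)
              rw [abs_le]; constructor <;> linarith
          _ ≤ D₁ * (2 * n + 2) := by
              refine mul_le_mul_of_nonneg_right (div_le_self hD₁ (by linarith)) (by positivity)
          _ = 2 * n * D₁ + 2 * D₁ := by ring
      calc |deriv (deriv χ) (G z) * (4 * G z) + deriv χ (G z) * (2 * (n - 1))|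
          ≤ 4 * D₂ + (2 * n * D₁ + 2 * D₁) := (abs_add_le _ _).trans (add_le_add h1 h2)
        _ ≤ 4 * D₁ ^ 2 + 4 * D₂ + 2 * n * D₁ + 1 := by nlinarith [sq_nonneg (D₁ - 1)]
  · have h1 : deriv χ (G z) = 0 := hχ'0 _ (by
      simp only [mem_Icc, not_and_or, not_le] at hz; exact hz)
    have h2 : deriv (deriv χ) (G z) = 0 := hχ''0 _ (by
      simp only [mem_Icc, not_and_or, not_le] at hz; exact hz)
    rw [hgS, hlapS, h1, h2]; simp

end YPrimeCutoff

/-! ### Products of two cut-offs -/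

section ProdCutoff

variable {E : Type*} [NormedAddCommGroup E] [InnerProductSpace ℝ E] [FiniteDimensional ℝ E]

/-- **Bounds for a product of two cut-offs.** For `f, h ∈ C²(U)` (`U` open, `z ∈ U`) with
`0 ≤ f(z) ≤ 1`, `|h(z)| ≤ 1`:
`((∂ₛ + Δ)(fh))² ≤ 3 (f² ((∂ₛ + Δ)h)² + ((∂ₛ + Δ)f)² + 4|∇f|²|∇h|²)` and
`|∇(fh)|² ≤ 2|∇h|² + 2|∇f|²` at `z`. [folklore] -/
theorem prod_cutoff_bounds {f h : ℝ × E → ℝ} {U : Set (ℝ × E)} {z : ℝ × E} (hU : IsOpen U)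
    (hz : z ∈ U) (hf : ContDiffOn ℝ 2 f U) (hh : ContDiffOn ℝ 2 h U) (hf0 : 0 ≤ f z)
    (hf1 : f z ≤ 1) (hh1 : |h z| ≤ 1) :
    (dt (fun y => f y * h y) z + lap (fun y => f y * h y) z) ^ 2 ≤
        3 * (f z ^ 2 * (dt h z + lap h z) ^ 2 + (dt f z + lap f z) ^ 2 +
          4 * (gradSq f z * gradSq h z)) ∧
      gradSq (fun y => f y * h y) z ≤ 2 * gradSq h z + 2 * gradSq f z := by
  have hfd : DifferentiableAt ℝ f z := (hf.differentiableOn (by norm_num)).differentiableAt (hU.mem_nhds hz)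
  have hhd : DifferentiableAt ℝ h z := (hh.differentiableOn (by norm_num)).differentiableAt (hU.mem_nhds hz)
  constructor
  · rw [dt_mul hfd hhd, lap_mul hU hz hf hh]
    set X : ℝ := f z * (dt h z + lap h z) with hX
    set Y : ℝ := dt f z + lap f z with hY
    set Z : ℝ := 2 * ∑ i, dx (stdOrthonormalBasis ℝ E i) f z * dx (stdOrthonormalBasis ℝ E i) h z
      with hZ
    have hcs := abs_sum_dx_mul_dx_le f h z
    have hZ2 : Z ^ 2 ≤ 4 * (gradSq f z * gradSq h z) := by
      rw [hZ, mul_pow]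
      have h1 : (∑ i, dx (stdOrthonormalBasis ℝ E i) f z * dx (stdOrthonormalBasis ℝ E i) h z) ^ 2 ≤
          (Real.sqrt (gradSq f z) * Real.sqrt (gradSq h z)) ^ 2 := by
        rw [← sq_abs]; exact pow_le_pow_left₀ (abs_nonneg _) hcs 2
      rw [mul_pow, Real.sq_sqrt (gradSq_nonneg f z), Real.sq_sqrt (gradSq_nonneg h z)] at h1
      linarith
    have hY2 : (h z * Y) ^ 2 ≤ Y ^ 2 := by
      rw [mul_pow]
      have : h z ^ 2 ≤ 1 := by
        have := sq_abs (h z); nlinarith [abs_nonneg (h z)]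
      nlinarith [sq_nonneg Y]
    have e' : f z * dt h z + h z * dt f z + (f z * lap h z + h z * lap f z + Z) = X + h z * Y + Z := by
      rw [hX, hY]; ring
    rw [e']
    nlinarith [sq_nonneg (X - h z * Y), sq_nonneg (X - Z), sq_nonneg (h z * Y - Z), hZ2, hY2]
  · refine (gradSq_mul_le hfd hhd).trans ?_
    have h1 : f z ^ 2 ≤ 1 := by nlinarith
    have h2 : h z ^ 2 ≤ 1 := by have := sq_abs (h z); nlinarith [abs_nonneg (h z)]
    nlinarith [gradSq_nonneg f z, gradSq_nonneg h z]

end ProdCutoff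

end Carleman

end Literature.Analysis.FluidPDE
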